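import Summits.FinalStateConjecture.FinalStateConjecture.Theorems.EIHFluxBalanceInertialRecessionSlavingFarFieldRowsA
import Summits.FinalStateConjecture.FinalStateConjecture.Theorems.EIHFluxBalanceInertialRecessionSlavingFarFieldSpinAtom

/-!
# Route EIHFluxBalance — `InertialRecession` (E′), K1 / stub `stub_coerMomKernel` (Bk), far field: rows of `𝓜[S]` for the boosted Lense–Thirring (spin-dipole) field, I (rows `P_1, P_2, P_3`)

Helper file for the crux `stmt-FinalStateConjecture-17403`. For the boosted linearised spin term `S` with spin vector `σ` (scalar closed form `(2/r³)(ℓ(U)⟪y⃗×σ,W⃗⟫ + ⟪y⃗×σ,U⃗⟫ℓ(W))` at `y = L⁻¹z`; `σ = e₃` gives `Kerr.spinMetric 1`), the flat momentum rows at `3e₁`: `0`, `−(2/27)γ⁻³σ₃`, `(2/27)γ⁻³σ₂`.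
Rational boost parametrisation: speed `v = 2s/(1+s²)` along `e₁`, `γ = (1+s²)/(1−s²)`, `|s| < 1` (for the kernel
statements take `0 ≤ s`, i.e. `v ≥ 0`, WLOG after a rotation). Proof pattern: `fderiv_kerrVar_apply` (F2a) /
`fderiv_ltAtom_apply` (F3a), the closed forms `fderiv_fderiv_bilin_zero_spin_apply` (F1), `Schwarzschild.dG`, the inverse
boost in coordinates (F2pre), then `field_simp; ring`. Values cross-checked against the exact rational-function
computation `work/k1/cert_lab.py` (evidence `K1_farfield_rows_lab_offsets.json`). No definitions, no `sorry`. [folklore]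
-/

set_option linter.dupNamespace false
-- instance search through the nested operator types (as in the skeleton / `ChartCurvature`)
set_option maxSynthPendingDepth 6
set_option synthInstance.maxHeartbeats 200000

noncomputable section

open scoped Topology InnerProductSpace
open Filter Set Function Literature.Geometry.Lorentzian Literature.Geometry.Lorentzian.Schwarzschild

namespace Summit.FinalStateConjecture.FinalStateConjecture.Theorems.SublinearIsFree.Slaving

set_option maxHeartbeats 1000000 in
/-- **Far-field spin row `P_1`**: `Σ_i (∂_iS_i1 − ∂_1S_ii)` at lab offset `3e₁` for the boosted Lense–Thirring
(spin-dipole) field `S` with spin vector `(σ₁,σ₂,σ₃)` (`L = boost((2s/(1+s²))e₁)`; rest-frame form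
`(2/r³)(ℓ(U)⟪y⃗ × σ, W⃗⟫ + ⟪y⃗ × σ, U⃗⟫ℓ(W))`, `σ = e₃` is `Kerr.spinMetric 1`) equals `0` (`v = 2s/(1+s²)`,
`γ = (1+s²)/(1−s²)`). Scalar form (`S z u w : ℝ`). [folklore] -/
theorem farField_spinRow_P1 {s : ℝ} (hs : |s| < 1)
    (hw : ‖((2 * s / (1 + s ^ 2)) • (EuclideanSpace.single 0 1 : E3))‖ < 1)
    (σ₁ σ₂ σ₃ : ℝ) (S : E4 → E4 → E4 → ℝ)
    (hS : ∀ z u w : E4, S z u w =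
      2 / E4.spatialNorm (((Lorentz.boost ((2 * s / (1 + s ^ 2)) • (EuclideanSpace.single 0 1 : E3)) hw) : E4 ≃L[ℝ] E4).symm z) ^ 3 *
        (ell (((Lorentz.boost ((2 * s / (1 + s ^ 2)) • (EuclideanSpace.single 0 1 : E3)) hw) : E4 ≃L[ℝ] E4).symm z) (((Lorentz.boost ((2 * s / (1 + s ^ 2)) • (EuclideanSpace.single 0 1 : E3)) hw) : E4 ≃L[ℝ] E4).symm u) * sdot (((Lorentz.boost ((2 * s / (1 + s ^ 2)) • (EuclideanSpace.single 0 1 : E3)) hw) : E4 ≃L[ℝ] E4).symm z) ((WithLp.toLp 2 ![(0 : ℝ), σ₂ * (((Lorentz.boost ((2 * s / (1 + s ^ 2)) • (EuclideanSpace.single 0 1 : E3)) hw) : E4 ≃L[ℝ] E4).symm w) 3 - σ₃ * (((Lorentz.boost ((2 * s / (1 + s ^ 2)) • (EuclideanSpace.single 0 1 : E3)) hw) : E4 ≃L[ℝ] E4).symm w) 2, σ₃ * (((Lorentz.boost ((2 * s / (1 + s ^ 2)) • (EuclideanSpace.single 0 1 : E3)) hw) : E4 ≃L[ℝ] E4).symm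 w) 1 - σ₁ * (((Lorentz.boost ((2 * s / (1 + s ^ 2)) • (EuclideanSpace.single 0 1 : E3)) hw) : E4 ≃L[ℝ] E4).symm w) 3, σ₁ * (((Lorentz.boost ((2 * s / (1 + s ^ 2)) • (EuclideanSpace.single 0 1 : E3)) hw) : E4 ≃L[ℝ] E4).symm w) 2 - σ₂ * (((Lorentz.boost ((2 * s / (1 + s ^ 2)) • (EuclideanSpace.single 0 1 : E3)) hw) : E4 ≃L[ℝ] E4).symm w) 1])) +
          sdot (((Lorentz.boost ((2 * s / (1 + s ^ 2)) • (EuclideanSpace.single 0 1 : E3)) hw) : E4 ≃L[ℝ] E4).symm z) ((WithLp.toLp 2 ![(0 : ℝ), σ₂ * (((Lorentz.boost ((2 * s / (1 + s ^ 2)) • (EuclideanSpace.single 0 1 : E3)) hw) : E4 ≃L[ℝ] E4).symm u) 3 - σ₃ * (((Lorentz.boost ((2 * s / (1 + s ^ 2)) • (EuclideanSpace.single 0 1 : E3)) hw) : E4 ≃L[ℝ] E4).symm u) 2, σ₃ * (((Lorentz.boost ((2 * s / (1 + s ^ 2)) • (EuclideanSpace.single 0 1 : E3)) hw) : E4 ≃L[ℝ]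 E4).symm u) 1 - σ₁ * (((Lorentz.boost ((2 * s / (1 + s ^ 2)) • (EuclideanSpace.single 0 1 : E3)) hw) : E4 ≃L[ℝ] E4).symm u) 3, σ₁ * (((Lorentz.boost ((2 * s / (1 + s ^ 2)) • (EuclideanSpace.single 0 1 : E3)) hw) : E4 ≃L[ℝ] E4).symm u) 2 - σ₂ * (((Lorentz.boost ((2 * s / (1 + s ^ 2)) • (EuclideanSpace.single 0 1 : E3)) hw) : E4 ≃L[ℝ] E4).symm u) 1])) * ell (((Lorentz.boost ((2 * s / (1 + s ^ 2)) • (EuclideanSpace.single 0 1 : E3)) hw) : E4 ≃L[ℝ] E4).symm z) (((Lorentz.boost ((2 * s / (1 + s ^ 2)) • (EuclideanSpace.single 0 1 : E3)) hw) : E4 ≃L[ℝ] E4).symm w))) :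
    ∑ i : Fin 3, (fderiv ℝ (fun z ↦ S z (E4.basisVector i.succ) (E4.basisVector 1)) (E4.ofTimeSpace 0 ((3 : ℝ) • EuclideanSpace.single 0 1))
        (E4.basisVector i.succ) -
      fderiv ℝ (fun z ↦ S z (E4.basisVector i.succ) (E4.basisVector i.succ)) (E4.ofTimeSpace 0 ((3 : ℝ) • EuclideanSpace.single 0 1))
        (E4.basisVector 1)) =
      0 := by
  have h1 : (1 : ℝ) + s ^ 2 ≠ 0 := by positivity
  have hs2 : s ^ 2 < 1 := by nlinarith [abs_nonneg s, sq_abs s, mul_pos (sub_pos.2 hs) (sub_pos.2 hs)]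
  have h2 : (1 : ℝ) - s ^ 2 ≠ 0 := by linarith
  have h3 : (1 : ℝ) + s ≠ 0 := by have := (abs_lt.1 hs).1; linarith
  have hLi := boost_vel_symm_apply hs hw
  have hL1 := boost_vel_symm_basisVector_one hs hw
  have hL2 := boost_vel_symm_basisVector_two hs hw
  have hL3 := boost_vel_symm_basisVector_three hs hw
  have hts1 : ∀ (t : ℝ) (y : E3), E4.ofTimeSpace t y 1 = y 0 := fun _ _ ↦ rfl
  have hts2 : ∀ (t : ℝ) (y : E3), E4.ofTimeSpace t y 2 = y 1 := fun _ _ ↦ rfl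
  have hts3 : ∀ (t : ℝ) (y : E3), E4.ofTimeSpace t y 3 = y 2 := fun _ _ ↦ rfl
  have hy : (((Lorentz.boost ((2 * s / (1 + s ^ 2)) • (EuclideanSpace.single 0 1 : E3)) hw) : E4 ≃L[ℝ] E4).symm (E4.ofTimeSpace 0 ((3 : ℝ) • EuclideanSpace.single 0 1))) = ![(-((2 * s / (1 - s ^ 2)) * 3) : ℝ), ((1 + s ^ 2) / (1 - s ^ 2)) * 3, 0, 0] := by
    rw [hLi]
    funext μ
    fin_cases μ <;> simp [hts1, hts2, hts3]
  have hyc : ((((Lorentz.boost ((2 * s / (1 + s ^ 2)) • (EuclideanSpace.single 0 1 : E3)) hw) : E4 ≃L[ℝ] E4).symm (E4.ofTimeSpace 0 ((3 : ℝ) • EuclideanSpace.single 0 1)))) 1 = ![(-((2 * s / (1 - s ^ 2)) * 3) : ℝ), ((1 + s ^ 2) / (1 - s ^ 2)) * 3, 0, 0] 1 := congrFun hy 1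
  have hsp : E4.spatial ((((Lorentz.boost ((2 * s / (1 + s ^ 2)) • (EuclideanSpace.single 0 1 : E3)) hw) : E4 ≃L[ℝ] E4).symm (E4.ofTimeSpace 0 ((3 : ℝ) • EuclideanSpace.single 0 1)))) ≠ 0 := by
    intro h
    have h' := congrArg (fun z : E3 ↦ z 0) h
    simp only [E4.spatial_apply, PiLp.zero_apply] at h'
    rw [show (0 : Fin 3).succ = 1 from rfl, hyc] at h'
    simp at h'
    rcases h' with h' | h'
    · exact h1 (by nlinarith [h'])
    · exact h2 h'
  have hnorm : E4.spatialNorm ((((Lorentz.boost ((2 * s / (1 + s ^ 2)) • (EuclideanSpace.single 0 1 : E3)) hw) : E4 ≃L[ℝ] E4).symm (E4.ofTimeSpace 0 ((3 : ℝ) • EuclideanSpace.single 0 1)))) = ((1 + s ^ 2) / (1 - s ^ 2)) * 3 := by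
    have hpos : (0 : ℝ) < ((1 + s ^ 2) / (1 - s ^ 2)) * 3 := by
      have : 0 < 1 - s ^ 2 := by linarith
      positivity
    rw [spatialNorm_eq_sqrt, congrFun hy 1, congrFun hy 2, congrFun hy 3, Real.sqrt_eq_iff_mul_self_eq_of_pos hpos]
    simp
    ring
  have hcomp : ∀ a b : E4, (fun z ↦ S z a b) =
      (fun y : E4 ↦ 2 / E4.spatialNorm y ^ 3 *
        (ell y (((Lorentz.boost ((2 * s / (1 + s ^ 2)) • (EuclideanSpace.single 0 1 : E3)) hw) : E4 ≃L[ℝ] E4).symm a) * sdot y ((WithLp.toLp 2 ![(0 : ℝ), σ₂ * (((Lorentz.boost ((2 * s / (1 + s ^ 2)) • (EuclideanSpace.single 0 1 : E3)) hw) : E4 ≃L[ℝ] E4).symm b) 3 - σ₃ * (((Lorentz.boost ((2 * s / (1 + s ^ 2)) • (EuclideanSpace.single 0 1 : E3)) hw) : E4 ≃L[ℝ] E4).symm b) 2, σ₃ * (((Lorentz.boost ((2 * s / (1 + s ^ 2)) • (EuclideanSpace.single 0 1 : E3)) hw) : E4 ≃L[ℝ] E4).symm b) 1 - σ₁ * (((Lorentz.boost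 ((2 * s / (1 + s ^ 2)) • (EuclideanSpace.single 0 1 : E3)) hw) : E4 ≃L[ℝ] E4).symm b) 3, σ₁ * (((Lorentz.boost ((2 * s / (1 + s ^ 2)) • (EuclideanSpace.single 0 1 : E3)) hw) : E4 ≃L[ℝ] E4).symm b) 2 - σ₂ * (((Lorentz.boost ((2 * s / (1 + s ^ 2)) • (EuclideanSpace.single 0 1 : E3)) hw) : E4 ≃L[ℝ] E4).symm b) 1])) + sdot y ((WithLp.toLp 2 ![(0 : ℝ), σ₂ * (((Lorentz.boost ((2 * s / (1 + s ^ 2)) • (EuclideanSpace.single 0 1 : E3)) hw) : E4 ≃L[ℝ] E4).symm a) 3 - σ₃ * (((Lorentz.boost ((2 * s / (1 + s ^ 2)) • (EuclideanSpace.single 0 1 : E3)) hw) : E4 ≃L[ℝ] E4).symm a) 2, σ₃ * (((Lorentz.boost ((2 * s / (1 + s ^ 2)) • (EuclideanSpace.single 0 1 : E3)) hw) : E4 ≃L[ℝ] E4).symm a) 1 - σ₁ * (((Lorentz.boost ((2 * s / (1 + s ^ 2)) • (EuclideanSpace.single 0 1 : E3)) hw) : E4 ≃L[ℝ] E4).symm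 a) 3, σ₁ * (((Lorentz.boost ((2 * s / (1 + s ^ 2)) • (EuclideanSpace.single 0 1 : E3)) hw) : E4 ≃L[ℝ] E4).symm a) 2 - σ₂ * (((Lorentz.boost ((2 * s / (1 + s ^ 2)) • (EuclideanSpace.single 0 1 : E3)) hw) : E4 ≃L[ℝ] E4).symm a) 1])) * ell y (((Lorentz.boost ((2 * s / (1 + s ^ 2)) • (EuclideanSpace.single 0 1 : E3)) hw) : E4 ≃L[ℝ] E4).symm b))) ∘
        ((((Lorentz.boost ((2 * s / (1 + s ^ 2)) • (EuclideanSpace.single 0 1 : E3)) hw) : E4 ≃L[ℝ] E4).symm : E4 →L[ℝ] E4)) := fun a b ↦ by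
    funext z
    simp only [Function.comp_apply, hS z a b]
    rfl
  have hD : ∀ a b c : E4, fderiv ℝ (fun z ↦ S z a b) (E4.ofTimeSpace 0 ((3 : ℝ) • EuclideanSpace.single 0 1)) c =
      fderiv ℝ (fun y : E4 ↦ 2 / E4.spatialNorm y ^ 3 *
        (ell y (((Lorentz.boost ((2 * s / (1 + s ^ 2)) • (EuclideanSpace.single 0 1 : E3)) hw) : E4 ≃L[ℝ] E4).symm a) * sdot y ((WithLp.toLp 2 ![(0 : ℝ), σ₂ * (((Lorentz.boost ((2 * s / (1 + s ^ 2)) • (EuclideanSpace.single 0 1 : E3)) hw) : E4 ≃L[ℝ] E4).symm b) 3 - σ₃ * (((Lorentz.boost ((2 * s / (1 + s ^ 2)) • (EuclideanSpace.single 0 1 : E3)) hw) : E4 ≃L[ℝ] E4).symm b) 2, σ₃ * (((Lorentz.boost ((2 * s / (1 + s ^ 2)) • (EuclideanSpace.single 0 1 : E3)) hw) : E4 ≃L[ℝ] E4).symm b) 1 - σ₁ * (((Lorentz.boost ((2 * s / (1 + s ^ 2)) • (EuclideanSpace.single 0 1 : E3)) hw) : E4 ≃L[ℝ] E4).symm b)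 3, σ₁ * (((Lorentz.boost ((2 * s / (1 + s ^ 2)) • (EuclideanSpace.single 0 1 : E3)) hw) : E4 ≃L[ℝ] E4).symm b) 2 - σ₂ * (((Lorentz.boost ((2 * s / (1 + s ^ 2)) • (EuclideanSpace.single 0 1 : E3)) hw) : E4 ≃L[ℝ] E4).symm b) 1])) + sdot y ((WithLp.toLp 2 ![(0 : ℝ), σ₂ * (((Lorentz.boost ((2 * s / (1 + s ^ 2)) • (EuclideanSpace.single 0 1 : E3)) hw) : E4 ≃L[ℝ] E4).symm a) 3 - σ₃ * (((Lorentz.boost ((2 * s / (1 + s ^ 2)) • (EuclideanSpace.single 0 1 : E3)) hw) : E4 ≃L[ℝ] E4).symm a) 2, σ₃ * (((Lorentz.boost ((2 * s / (1 + s ^ 2)) • (EuclideanSpace.single 0 1 : E3)) hw) : E4 ≃L[ℝ] E4).symm a) 1 - σ₁ * (((Lorentz.boost ((2 * s / (1 + s ^ 2)) • (EuclideanSpace.single 0 1 : E3)) hw) : E4 ≃L[ℝ] E4).symm a) 3, σ₁ * (((Lorentz.boost ((2 * s / (1 + s ^ 2)) • (EuclideanSpace.single 0 1 : E3)) hw)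 : E4 ≃L[ℝ] E4).symm a) 2 - σ₂ * (((Lorentz.boost ((2 * s / (1 + s ^ 2)) • (EuclideanSpace.single 0 1 : E3)) hw) : E4 ≃L[ℝ] E4).symm a) 1])) * ell y (((Lorentz.boost ((2 * s / (1 + s ^ 2)) • (EuclideanSpace.single 0 1 : E3)) hw) : E4 ≃L[ℝ] E4).symm b))) (((Lorentz.boost ((2 * s / (1 + s ^ 2)) • (EuclideanSpace.single 0 1 : E3)) hw) : E4 ≃L[ℝ] E4).symm (E4.ofTimeSpace 0 ((3 : ℝ) • EuclideanSpace.single 0 1))) (((Lorentz.boost ((2 * s / (1 + s ^ 2)) • (EuclideanSpace.single 0 1 : E3)) hw) : E4 ≃L[ℝ] E4).symm c) := by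
    intro a b c
    have hat := hasFDerivAt_ltAtom hsp (((Lorentz.boost ((2 * s / (1 + s ^ 2)) • (EuclideanSpace.single 0 1 : E3)) hw) : E4 ≃L[ℝ] E4).symm a) (((Lorentz.boost ((2 * s / (1 + s ^ 2)) • (EuclideanSpace.single 0 1 : E3)) hw) : E4 ≃L[ℝ] E4).symm b) (WithLp.toLp 2 ![(0 : ℝ), σ₂ * (((Lorentz.boost ((2 * s / (1 + s ^ 2)) • (EuclideanSpace.single 0 1 : E3)) hw) : E4 ≃L[ℝ] E4).symm a) 3 - σ₃ * (((Lorentz.boost ((2 * s / (1 + s ^ 2)) • (EuclideanSpace.single 0 1 : E3)) hw) : E4 ≃L[ℝ] E4).symm a) 2, σ₃ * (((Lorentz.boost ((2 * s / (1 + s ^ 2)) • (EuclideanSpace.single 0 1 : E3)) hw) : E4 ≃L[ℝ] E4).symm a) 1 - σ₁ * (((Lorentz.boost ((2 * s / (1 + s ^ 2)) • (EuclideanSpace.single 0 1 : E3)) hw) : E4 ≃L[ℝ] E4).symm a) 3, σ₁ * (((Lorentz.boost ((2 * s / (1 + s ^ 2)) • (EuclideanSpace.single 0 1 : E3)) hw)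 : E4 ≃L[ℝ] E4).symm a) 2 - σ₂ * (((Lorentz.boost ((2 * s / (1 + s ^ 2)) • (EuclideanSpace.single 0 1 : E3)) hw) : E4 ≃L[ℝ] E4).symm a) 1]) (WithLp.toLp 2 ![(0 : ℝ), σ₂ * (((Lorentz.boost ((2 * s / (1 + s ^ 2)) • (EuclideanSpace.single 0 1 : E3)) hw) : E4 ≃L[ℝ] E4).symm b) 3 - σ₃ * (((Lorentz.boost ((2 * s / (1 + s ^ 2)) • (EuclideanSpace.single 0 1 : E3)) hw) : E4 ≃L[ℝ] E4).symm b) 2, σ₃ * (((Lorentz.boost ((2 * s / (1 + s ^ 2)) • (EuclideanSpace.single 0 1 : E3)) hw) : E4 ≃L[ℝ] E4).symm b) 1 - σ₁ * (((Lorentz.boost ((2 * s / (1 + s ^ 2)) • (EuclideanSpace.single 0 1 : E3)) hw) : E4 ≃L[ℝ] E4).symm b) 3, σ₁ * (((Lorentz.boost ((2 * s / (1 + s ^ 2)) • (EuclideanSpace.single 0 1 : E3)) hw) : E4 ≃L[ℝ] E4).symm b) 2 - σ₂ * (((Lorentz.boost ((2 * s / (1 + s ^ 2)) • (EuclideanSpace.single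 0 1 : E3)) hw) : E4 ≃L[ℝ] E4).symm b) 1])
    have hSD := (hat.comp (E4.ofTimeSpace 0 ((3 : ℝ) • EuclideanSpace.single 0 1)) (((((Lorentz.boost ((2 * s / (1 + s ^ 2)) • (EuclideanSpace.single 0 1 : E3)) hw) : E4 ≃L[ℝ] E4).symm : E4 →L[ℝ] E4)).hasFDerivAt)).congr_of_eventuallyEq
      (Filter.EventuallyEq.of_eq (hcomp a b))
    rw [hSD.fderiv, ← hat.fderiv]
    rfl
  have hs3 : ((2 : Fin 3).succ : Fin 4) = 3 := rfl
  rw [Fin.sum_univ_three]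
  simp only [Fin.succ_zero_eq_one, Fin.succ_one_eq_two, hs3, hD, fderiv_ltAtom_apply hsp]
  simp only [ell, dEll, sdot_eq, hnorm]
  simp only [hy, hL1, hL2, hL3, Matrix.cons_val_zero, Matrix.cons_val_one,
    Matrix.head_cons, Matrix.cons_val_two, Matrix.tail_cons, Matrix.cons_val_three,
    mul_zero, zero_mul, add_zero, zero_add, mul_one, sub_zero, zero_sub, neg_zero, zero_div, mul_neg, neg_mul]

set_option maxHeartbeats 1000000 in
/-- **Far-field spin row `P_2`**: `Σ_i (∂_iS_i2 − ∂_2S_ii)` at lab offset `3e₁` for the boosted Lense–Thirring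
(spin-dipole) field `S` with spin vector `(σ₁,σ₂,σ₃)` (`L = boost((2s/(1+s²))e₁)`; rest-frame form
`(2/r³)(ℓ(U)⟪y⃗ × σ, W⃗⟫ + ⟪y⃗ × σ, U⃗⟫ℓ(W))`, `σ = e₃` is `Kerr.spinMetric 1`) equals `−(2/27)γ⁻³·σ₃` (`v = 2s/(1+s²)`,
`γ = (1+s²)/(1−s²)`). Scalar form (`S z u w : ℝ`). [folklore] -/
theorem farField_spinRow_P2 {s : ℝ} (hs : |s| < 1)
    (hw : ‖((2 * s / (1 + s ^ 2)) • (EuclideanSpace.single 0 1 : E3))‖ < 1)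
    (σ₁ σ₂ σ₃ : ℝ) (S : E4 → E4 → E4 → ℝ)
    (hS : ∀ z u w : E4, S z u w =
      2 / E4.spatialNorm (((Lorentz.boost ((2 * s / (1 + s ^ 2)) • (EuclideanSpace.single 0 1 : E3)) hw) : E4 ≃L[ℝ] E4).symm z) ^ 3 *
        (ell (((Lorentz.boost ((2 * s / (1 + s ^ 2)) • (EuclideanSpace.single 0 1 : E3)) hw) : E4 ≃L[ℝ] E4).symm z) (((Lorentz.boost ((2 * s / (1 + s ^ 2)) • (EuclideanSpace.single 0 1 : E3)) hw) : E4 ≃L[ℝ] E4).symm u) * sdot (((Lorentz.boost ((2 * s / (1 + s ^ 2)) • (EuclideanSpace.single 0 1 : E3)) hw) : E4 ≃L[ℝ] E4).symm z) ((WithLp.toLp 2 ![(0 : ℝ), σ₂ * (((Lorentz.boost ((2 * s / (1 + s ^ 2)) • (EuclideanSpace.single 0 1 : E3)) hw) : E4 ≃L[ℝ] E4).symm w) 3 - σ₃ * (((Lorentz.boost ((2 * s / (1 + s ^ 2)) • (EuclideanSpace.single 0 1 : E3)) hw) : E4 ≃L[ℝ] E4).symm w) 2, σ₃ * (((Lorentz.boost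 ((2 * s / (1 + s ^ 2)) • (EuclideanSpace.single 0 1 : E3)) hw) : E4 ≃L[ℝ] E4).symm w) 1 - σ₁ * (((Lorentz.boost ((2 * s / (1 + s ^ 2)) • (EuclideanSpace.single 0 1 : E3)) hw) : E4 ≃L[ℝ] E4).symm w) 3, σ₁ * (((Lorentz.boost ((2 * s / (1 + s ^ 2)) • (EuclideanSpace.single 0 1 : E3)) hw) : E4 ≃L[ℝ] E4).symm w) 2 - σ₂ * (((Lorentz.boost ((2 * s / (1 + s ^ 2)) • (EuclideanSpace.single 0 1 : E3)) hw) : E4 ≃L[ℝ] E4).symm w) 1])) +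
          sdot (((Lorentz.boost ((2 * s / (1 + s ^ 2)) • (EuclideanSpace.single 0 1 : E3)) hw) : E4 ≃L[ℝ] E4).symm z) ((WithLp.toLp 2 ![(0 : ℝ), σ₂ * (((Lorentz.boost ((2 * s / (1 + s ^ 2)) • (EuclideanSpace.single 0 1 : E3)) hw) : E4 ≃L[ℝ] E4).symm u) 3 - σ₃ * (((Lorentz.boost ((2 * s / (1 + s ^ 2)) • (EuclideanSpace.single 0 1 : E3)) hw) : E4 ≃L[ℝ] E4).symm u) 2, σ₃ * (((Lorentz.boost ((2 * s / (1 + s ^ 2)) • (EuclideanSpace.single 0 1 : E3)) hw) : E4 ≃L[ℝ] E4).symm u) 1 - σ₁ * (((Lorentz.boost ((2 * s / (1 + s ^ 2)) • (EuclideanSpace.single 0 1 : E3)) hw) : E4 ≃L[ℝ] E4).symm u) 3, σ₁ * (((Lorentz.boost ((2 * s / (1 + s ^ 2)) • (EuclideanSpace.single 0 1 : E3)) hw) : E4 ≃L[ℝ] E4).symm u) 2 - σ₂ * (((Lorentz.boost ((2 * s / (1 + s ^ 2)) • (EuclideanSpace.single 0 1 : E3)) hw) : E4 ≃L[ℝ]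 E4).symm u) 1])) * ell (((Lorentz.boost ((2 * s / (1 + s ^ 2)) • (EuclideanSpace.single 0 1 : E3)) hw) : E4 ≃L[ℝ] E4).symm z) (((Lorentz.boost ((2 * s / (1 + s ^ 2)) • (EuclideanSpace.single 0 1 : E3)) hw) : E4 ≃L[ℝ] E4).symm w))) :
    ∑ i : Fin 3, (fderiv ℝ (fun z ↦ S z (E4.basisVector i.succ) (E4.basisVector 2)) (E4.ofTimeSpace 0 ((3 : ℝ) • EuclideanSpace.single 0 1))
        (E4.basisVector i.succ) -
      fderiv ℝ (fun z ↦ S z (E4.basisVector i.succ) (E4.basisVector i.succ)) (E4.ofTimeSpace 0 ((3 : ℝ) • EuclideanSpace.single 0 1))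
        (E4.basisVector 2)) =
      -(2 / 27) * ((1 - s ^ 2) / (1 + s ^ 2)) ^ 3 * σ₃ := by
  have h1 : (1 : ℝ) + s ^ 2 ≠ 0 := by positivity
  have hs2 : s ^ 2 < 1 := by nlinarith [abs_nonneg s, sq_abs s, mul_pos (sub_pos.2 hs) (sub_pos.2 hs)]
  have h2 : (1 : ℝ) - s ^ 2 ≠ 0 := by linarith
  have h3 : (1 : ℝ) + s ≠ 0 := by have := (abs_lt.1 hs).1; linarith
  have hLi := boost_vel_symm_apply hs hw
  have hL1 := boost_vel_symm_basisVector_one hs hw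
  have hL2 := boost_vel_symm_basisVector_two hs hw
  have hL3 := boost_vel_symm_basisVector_three hs hw
  have hts1 : ∀ (t : ℝ) (y : E3), E4.ofTimeSpace t y 1 = y 0 := fun _ _ ↦ rfl
  have hts2 : ∀ (t : ℝ) (y : E3), E4.ofTimeSpace t y 2 = y 1 := fun _ _ ↦ rfl
  have hts3 : ∀ (t : ℝ) (y : E3), E4.ofTimeSpace t y 3 = y 2 := fun _ _ ↦ rfl
  have hy : (((Lorentz.boost ((2 * s / (1 + s ^ 2)) • (EuclideanSpace.single 0 1 : E3)) hw) : E4 ≃L[ℝ] E4).symm (E4.ofTimeSpace 0 ((3 : ℝ) • EuclideanSpace.single 0 1))) = ![(-((2 * s / (1 - s ^ 2)) * 3) : ℝ), ((1 + s ^ 2) / (1 - s ^ 2)) * 3, 0, 0] := by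
    rw [hLi]
    funext μ
    fin_cases μ <;> simp [hts1, hts2, hts3]
  have hyc : ((((Lorentz.boost ((2 * s / (1 + s ^ 2)) • (EuclideanSpace.single 0 1 : E3)) hw) : E4 ≃L[ℝ] E4).symm (E4.ofTimeSpace 0 ((3 : ℝ) • EuclideanSpace.single 0 1)))) 1 = ![(-((2 * s / (1 - s ^ 2)) * 3) : ℝ), ((1 + s ^ 2) / (1 - s ^ 2)) * 3, 0, 0] 1 := congrFun hy 1
  have hsp : E4.spatial ((((Lorentz.boost ((2 * s / (1 + s ^ 2)) • (EuclideanSpace.single 0 1 : E3)) hw) : E4 ≃L[ℝ] E4).symm (E4.ofTimeSpace 0 ((3 : ℝ) • EuclideanSpace.single 0 1)))) ≠ 0 := by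
    intro h
    have h' := congrArg (fun z : E3 ↦ z 0) h
    simp only [E4.spatial_apply, PiLp.zero_apply] at h'
    rw [show (0 : Fin 3).succ = 1 from rfl, hyc] at h'
    simp at h'
    rcases h' with h' | h'
    · exact h1 (by nlinarith [h'])
    · exact h2 h'
  have hnorm : E4.spatialNorm ((((Lorentz.boost ((2 * s / (1 + s ^ 2)) • (EuclideanSpace.single 0 1 : E3)) hw) : E4 ≃L[ℝ] E4).symm (E4.ofTimeSpace 0 ((3 : ℝ) • EuclideanSpace.single 0 1)))) = ((1 + s ^ 2) / (1 - s ^ 2)) * 3 := by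
    have hpos : (0 : ℝ) < ((1 + s ^ 2) / (1 - s ^ 2)) * 3 := by
      have : 0 < 1 - s ^ 2 := by linarith
      positivity
    rw [spatialNorm_eq_sqrt, congrFun hy 1, congrFun hy 2, congrFun hy 3, Real.sqrt_eq_iff_mul_self_eq_of_pos hpos]
    simp
    ring
  have hcomp : ∀ a b : E4, (fun z ↦ S z a b) =
      (fun y : E4 ↦ 2 / E4.spatialNorm y ^ 3 *
        (ell y (((Lorentz.boost ((2 * s / (1 + s ^ 2)) • (EuclideanSpace.single 0 1 : E3)) hw) : E4 ≃L[ℝ] E4).symm a) * sdot y ((WithLp.toLp 2 ![(0 : ℝ), σ₂ * (((Lorentz.boost ((2 * s / (1 + s ^ 2)) • (EuclideanSpace.single 0 1 : E3)) hw) : E4 ≃L[ℝ] E4).symm b) 3 - σ₃ * (((Lorentz.boost ((2 * s / (1 + s ^ 2)) • (EuclideanSpace.single 0 1 : E3)) hw) : E4 ≃L[ℝ] E4).symm b) 2, σ₃ * (((Lorentz.boost ((2 * s / (1 + s ^ 2)) • (EuclideanSpace.single 0 1 : E3)) hw) : E4 ≃L[ℝ] E4).symm b) 1 - σ₁ * (((Lorentz.boost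 ((2 * s / (1 + s ^ 2)) • (EuclideanSpace.single 0 1 : E3)) hw) : E4 ≃L[ℝ] E4).symm b) 3, σ₁ * (((Lorentz.boost ((2 * s / (1 + s ^ 2)) • (EuclideanSpace.single 0 1 : E3)) hw) : E4 ≃L[ℝ] E4).symm b) 2 - σ₂ * (((Lorentz.boost ((2 * s / (1 + s ^ 2)) • (EuclideanSpace.single 0 1 : E3)) hw) : E4 ≃L[ℝ] E4).symm b) 1])) + sdot y ((WithLp.toLp 2 ![(0 : ℝ), σ₂ * (((Lorentz.boost ((2 * s / (1 + s ^ 2)) • (EuclideanSpace.single 0 1 : E3)) hw) : E4 ≃L[ℝ] E4).symm a) 3 - σ₃ * (((Lorentz.boost ((2 * s / (1 + s ^ 2)) • (EuclideanSpace.single 0 1 : E3)) hw) : E4 ≃L[ℝ] E4).symm a) 2, σ₃ * (((Lorentz.boost ((2 * s / (1 + s ^ 2)) • (EuclideanSpace.single 0 1 : E3)) hw) : E4 ≃L[ℝ] E4).symm a) 1 - σ₁ * (((Lorentz.boost ((2 * s / (1 + s ^ 2)) • (EuclideanSpace.single 0 1 : E3)) hw) : E4 ≃L[ℝ] E4).symm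 a) 3, σ₁ * (((Lorentz.boost ((2 * s / (1 + s ^ 2)) • (EuclideanSpace.single 0 1 : E3)) hw) : E4 ≃L[ℝ] E4).symm a) 2 - σ₂ * (((Lorentz.boost ((2 * s / (1 + s ^ 2)) • (EuclideanSpace.single 0 1 : E3)) hw) : E4 ≃L[ℝ] E4).symm a) 1])) * ell y (((Lorentz.boost ((2 * s / (1 + s ^ 2)) • (EuclideanSpace.single 0 1 : E3)) hw) : E4 ≃L[ℝ] E4).symm b))) ∘
        ((((Lorentz.boost ((2 * s / (1 + s ^ 2)) • (EuclideanSpace.single 0 1 : E3)) hw) : E4 ≃L[ℝ] E4).symm : E4 →L[ℝ] E4)) := fun a b ↦ by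
    funext z
    simp only [Function.comp_apply, hS z a b]
    rfl
  have hD : ∀ a b c : E4, fderiv ℝ (fun z ↦ S z a b) (E4.ofTimeSpace 0 ((3 : ℝ) • EuclideanSpace.single 0 1)) c =
      fderiv ℝ (fun y : E4 ↦ 2 / E4.spatialNorm y ^ 3 *
        (ell y (((Lorentz.boost ((2 * s / (1 + s ^ 2)) • (EuclideanSpace.single 0 1 : E3)) hw) : E4 ≃L[ℝ] E4).symm a) * sdot y ((WithLp.toLp 2 ![(0 : ℝ), σ₂ * (((Lorentz.boost ((2 * s / (1 + s ^ 2)) • (EuclideanSpace.single 0 1 : E3)) hw) : E4 ≃L[ℝ] E4).symm b) 3 - σ₃ * (((Lorentz.boost ((2 * s / (1 + s ^ 2)) • (EuclideanSpace.single 0 1 : E3)) hw) : E4 ≃L[ℝ] E4).symm b) 2, σ₃ * (((Lorentz.boost ((2 * s / (1 + s ^ 2)) • (EuclideanSpace.single 0 1 : E3)) hw) : E4 ≃L[ℝ] E4).symm b) 1 - σ₁ * (((Lorentz.boost ((2 * s / (1 + s ^ 2)) • (EuclideanSpace.single 0 1 : E3)) hw) : E4 ≃L[ℝ] E4).symm b)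 3, σ₁ * (((Lorentz.boost ((2 * s / (1 + s ^ 2)) • (EuclideanSpace.single 0 1 : E3)) hw) : E4 ≃L[ℝ] E4).symm b) 2 - σ₂ * (((Lorentz.boost ((2 * s / (1 + s ^ 2)) • (EuclideanSpace.single 0 1 : E3)) hw) : E4 ≃L[ℝ] E4).symm b) 1])) + sdot y ((WithLp.toLp 2 ![(0 : ℝ), σ₂ * (((Lorentz.boost ((2 * s / (1 + s ^ 2)) • (EuclideanSpace.single 0 1 : E3)) hw) : E4 ≃L[ℝ] E4).symm a) 3 - σ₃ * (((Lorentz.boost ((2 * s / (1 + s ^ 2)) • (EuclideanSpace.single 0 1 : E3)) hw) : E4 ≃L[ℝ] E4).symm a) 2, σ₃ * (((Lorentz.boost ((2 * s / (1 + s ^ 2)) • (EuclideanSpace.single 0 1 : E3)) hw) : E4 ≃L[ℝ] E4).symm a) 1 - σ₁ * (((Lorentz.boost ((2 * s / (1 + s ^ 2)) • (EuclideanSpace.single 0 1 : E3)) hw) : E4 ≃L[ℝ] E4).symm a) 3, σ₁ * (((Lorentz.boost ((2 * s / (1 + s ^ 2)) • (EuclideanSpace.single 0 1 : E3)) hw)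 : E4 ≃L[ℝ] E4).symm a) 2 - σ₂ * (((Lorentz.boost ((2 * s / (1 + s ^ 2)) • (EuclideanSpace.single 0 1 : E3)) hw) : E4 ≃L[ℝ] E4).symm a) 1])) * ell y (((Lorentz.boost ((2 * s / (1 + s ^ 2)) • (EuclideanSpace.single 0 1 : E3)) hw) : E4 ≃L[ℝ] E4).symm b))) (((Lorentz.boost ((2 * s / (1 + s ^ 2)) • (EuclideanSpace.single 0 1 : E3)) hw) : E4 ≃L[ℝ] E4).symm (E4.ofTimeSpace 0 ((3 : ℝ) • EuclideanSpace.single 0 1))) (((Lorentz.boost ((2 * s / (1 + s ^ 2)) • (EuclideanSpace.single 0 1 : E3)) hw) : E4 ≃L[ℝ] E4).symm c) := by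
    intro a b c
    have hat := hasFDerivAt_ltAtom hsp (((Lorentz.boost ((2 * s / (1 + s ^ 2)) • (EuclideanSpace.single 0 1 : E3)) hw) : E4 ≃L[ℝ] E4).symm a) (((Lorentz.boost ((2 * s / (1 + s ^ 2)) • (EuclideanSpace.single 0 1 : E3)) hw) : E4 ≃L[ℝ] E4).symm b) (WithLp.toLp 2 ![(0 : ℝ), σ₂ * (((Lorentz.boost ((2 * s / (1 + s ^ 2)) • (EuclideanSpace.single 0 1 : E3)) hw) : E4 ≃L[ℝ] E4).symm a) 3 - σ₃ * (((Lorentz.boost ((2 * s / (1 + s ^ 2)) • (EuclideanSpace.single 0 1 : E3)) hw) : E4 ≃L[ℝ] E4).symm a) 2, σ₃ * (((Lorentz.boost ((2 * s / (1 + s ^ 2)) • (EuclideanSpace.single 0 1 : E3)) hw) : E4 ≃L[ℝ] E4).symm a) 1 - σ₁ * (((Lorentz.boost ((2 * s / (1 + s ^ 2)) • (EuclideanSpace.single 0 1 : E3)) hw) : E4 ≃L[ℝ] E4).symm a) 3, σ₁ * (((Lorentz.boost ((2 * s / (1 + s ^ 2)) • (EuclideanSpace.single 0 1 : E3)) hw)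 : E4 ≃L[ℝ] E4).symm a) 2 - σ₂ * (((Lorentz.boost ((2 * s / (1 + s ^ 2)) • (EuclideanSpace.single 0 1 : E3)) hw) : E4 ≃L[ℝ] E4).symm a) 1]) (WithLp.toLp 2 ![(0 : ℝ), σ₂ * (((Lorentz.boost ((2 * s / (1 + s ^ 2)) • (EuclideanSpace.single 0 1 : E3)) hw) : E4 ≃L[ℝ] E4).symm b) 3 - σ₃ * (((Lorentz.boost ((2 * s / (1 + s ^ 2)) • (EuclideanSpace.single 0 1 : E3)) hw) : E4 ≃L[ℝ] E4).symm b) 2, σ₃ * (((Lorentz.boost ((2 * s / (1 + s ^ 2)) • (EuclideanSpace.single 0 1 : E3)) hw) : E4 ≃L[ℝ] E4).symm b) 1 - σ₁ * (((Lorentz.boost ((2 * s / (1 + s ^ 2)) • (EuclideanSpace.single 0 1 : E3)) hw) : E4 ≃L[ℝ] E4).symm b) 3, σ₁ * (((Lorentz.boost ((2 * s / (1 + s ^ 2)) • (EuclideanSpace.single 0 1 : E3)) hw) : E4 ≃L[ℝ] E4).symm b) 2 - σ₂ * (((Lorentz.boost ((2 * s / (1 + s ^ 2)) • (EuclideanSpace.single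 0 1 : E3)) hw) : E4 ≃L[ℝ] E4).symm b) 1])
    have hSD := (hat.comp (E4.ofTimeSpace 0 ((3 : ℝ) • EuclideanSpace.single 0 1)) (((((Lorentz.boost ((2 * s / (1 + s ^ 2)) • (EuclideanSpace.single 0 1 : E3)) hw) : E4 ≃L[ℝ] E4).symm : E4 →L[ℝ] E4)).hasFDerivAt)).congr_of_eventuallyEq
      (Filter.EventuallyEq.of_eq (hcomp a b))
    rw [hSD.fderiv, ← hat.fderiv]
    rfl
  have hs3 : ((2 : Fin 3).succ : Fin 4) = 3 := rfl
  rw [Fin.sum_univ_three]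
  simp only [Fin.succ_zero_eq_one, Fin.succ_one_eq_two, hs3, hD, fderiv_ltAtom_apply hsp]
  simp only [ell, dEll, sdot_eq, hnorm]
  simp only [hy, hL1, hL2, hL3, Matrix.cons_val_zero, Matrix.cons_val_one,
    Matrix.head_cons, Matrix.cons_val_two, Matrix.tail_cons, Matrix.cons_val_three,
    mul_zero, zero_mul, add_zero, zero_add, mul_one, sub_zero, zero_sub, neg_zero, zero_div, mul_neg, neg_mul]
  field_simp
  ring

set_option maxHeartbeats 1000000 in
/-- **Far-field spin row `P_3`**: `Σ_i (∂_iS_i3 − ∂_3S_ii)` at lab offset `3e₁` for the boosted Lense–Thirring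
(spin-dipole) field `S` with spin vector `(σ₁,σ₂,σ₃)` (`L = boost((2s/(1+s²))e₁)`; rest-frame form
`(2/r³)(ℓ(U)⟪y⃗ × σ, W⃗⟫ + ⟪y⃗ × σ, U⃗⟫ℓ(W))`, `σ = e₃` is `Kerr.spinMetric 1`) equals `(2/27)γ⁻³·σ₂` (`v = 2s/(1+s²)`,
`γ = (1+s²)/(1−s²)`). Scalar form (`S z u w : ℝ`). [folklore] -/
theorem farField_spinRow_P3 {s : ℝ} (hs : |s| < 1)
    (hw : ‖((2 * s / (1 + s ^ 2)) • (EuclideanSpace.single 0 1 : E3))‖ < 1)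
    (σ₁ σ₂ σ₃ : ℝ) (S : E4 → E4 → E4 → ℝ)
    (hS : ∀ z u w : E4, S z u w =
      2 / E4.spatialNorm (((Lorentz.boost ((2 * s / (1 + s ^ 2)) • (EuclideanSpace.single 0 1 : E3)) hw) : E4 ≃L[ℝ] E4).symm z) ^ 3 *
        (ell (((Lorentz.boost ((2 * s / (1 + s ^ 2)) • (EuclideanSpace.single 0 1 : E3)) hw) : E4 ≃L[ℝ] E4).symm z) (((Lorentz.boost ((2 * s / (1 + s ^ 2)) • (EuclideanSpace.single 0 1 : E3)) hw) : E4 ≃L[ℝ] E4).symm u) * sdot (((Lorentz.boost ((2 * s / (1 + s ^ 2)) • (EuclideanSpace.single 0 1 : E3)) hw) : E4 ≃L[ℝ] E4).symm z) ((WithLp.toLp 2 ![(0 : ℝ), σ₂ * (((Lorentz.boost ((2 * s / (1 + s ^ 2)) • (EuclideanSpace.single 0 1 : E3)) hw) : E4 ≃L[ℝ] E4).symm w) 3 - σ₃ * (((Lorentz.boost ((2 * s / (1 + s ^ 2)) • (EuclideanSpace.single 0 1 : E3)) hw) : E4 ≃L[ℝ] E4).symm w) 2, σ₃ * (((Lorentz.boost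 ((2 * s / (1 + s ^ 2)) • (EuclideanSpace.single 0 1 : E3)) hw) : E4 ≃L[ℝ] E4).symm w) 1 - σ₁ * (((Lorentz.boost ((2 * s / (1 + s ^ 2)) • (EuclideanSpace.single 0 1 : E3)) hw) : E4 ≃L[ℝ] E4).symm w) 3, σ₁ * (((Lorentz.boost ((2 * s / (1 + s ^ 2)) • (EuclideanSpace.single 0 1 : E3)) hw) : E4 ≃L[ℝ] E4).symm w) 2 - σ₂ * (((Lorentz.boost ((2 * s / (1 + s ^ 2)) • (EuclideanSpace.single 0 1 : E3)) hw) : E4 ≃L[ℝ] E4).symm w) 1])) +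
          sdot (((Lorentz.boost ((2 * s / (1 + s ^ 2)) • (EuclideanSpace.single 0 1 : E3)) hw) : E4 ≃L[ℝ] E4).symm z) ((WithLp.toLp 2 ![(0 : ℝ), σ₂ * (((Lorentz.boost ((2 * s / (1 + s ^ 2)) • (EuclideanSpace.single 0 1 : E3)) hw) : E4 ≃L[ℝ] E4).symm u) 3 - σ₃ * (((Lorentz.boost ((2 * s / (1 + s ^ 2)) • (EuclideanSpace.single 0 1 : E3)) hw) : E4 ≃L[ℝ] E4).symm u) 2, σ₃ * (((Lorentz.boost ((2 * s / (1 + s ^ 2)) • (EuclideanSpace.single 0 1 : E3)) hw) : E4 ≃L[ℝ] E4).symm u) 1 - σ₁ * (((Lorentz.boost ((2 * s / (1 + s ^ 2)) • (EuclideanSpace.single 0 1 : E3)) hw) : E4 ≃L[ℝ] E4).symm u) 3, σ₁ * (((Lorentz.boost ((2 * s / (1 + s ^ 2)) • (EuclideanSpace.single 0 1 : E3)) hw) : E4 ≃L[ℝ] E4).symm u) 2 - σ₂ * (((Lorentz.boost ((2 * s / (1 + s ^ 2)) • (EuclideanSpace.single 0 1 : E3)) hw) : E4 ≃L[ℝ]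 E4).symm u) 1])) * ell (((Lorentz.boost ((2 * s / (1 + s ^ 2)) • (EuclideanSpace.single 0 1 : E3)) hw) : E4 ≃L[ℝ] E4).symm z) (((Lorentz.boost ((2 * s / (1 + s ^ 2)) • (EuclideanSpace.single 0 1 : E3)) hw) : E4 ≃L[ℝ] E4).symm w))) :
    ∑ i : Fin 3, (fderiv ℝ (fun z ↦ S z (E4.basisVector i.succ) (E4.basisVector 3)) (E4.ofTimeSpace 0 ((3 : ℝ) • EuclideanSpace.single 0 1))
        (E4.basisVector i.succ) -
      fderiv ℝ (fun z ↦ S z (E4.basisVector i.succ) (E4.basisVector i.succ)) (E4.ofTimeSpace 0 ((3 : ℝ) • EuclideanSpace.single 0 1))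
        (E4.basisVector 3)) =
      2 / 27 * ((1 - s ^ 2) / (1 + s ^ 2)) ^ 3 * σ₂ := by
  have h1 : (1 : ℝ) + s ^ 2 ≠ 0 := by positivity
  have hs2 : s ^ 2 < 1 := by nlinarith [abs_nonneg s, sq_abs s, mul_pos (sub_pos.2 hs) (sub_pos.2 hs)]
  have h2 : (1 : ℝ) - s ^ 2 ≠ 0 := by linarith
  have h3 : (1 : ℝ) + s ≠ 0 := by have := (abs_lt.1 hs).1; linarith
  have hLi := boost_vel_symm_apply hs hw
  have hL1 := boost_vel_symm_basisVector_one hs hw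
  have hL2 := boost_vel_symm_basisVector_two hs hw
  have hL3 := boost_vel_symm_basisVector_three hs hw
  have hts1 : ∀ (t : ℝ) (y : E3), E4.ofTimeSpace t y 1 = y 0 := fun _ _ ↦ rfl
  have hts2 : ∀ (t : ℝ) (y : E3), E4.ofTimeSpace t y 2 = y 1 := fun _ _ ↦ rfl
  have hts3 : ∀ (t : ℝ) (y : E3), E4.ofTimeSpace t y 3 = y 2 := fun _ _ ↦ rfl
  have hy : (((Lorentz.boost ((2 * s / (1 + s ^ 2)) • (EuclideanSpace.single 0 1 : E3)) hw) : E4 ≃L[ℝ] E4).symm (E4.ofTimeSpace 0 ((3 : ℝ) • EuclideanSpace.single 0 1))) = ![(-((2 * s / (1 - s ^ 2)) * 3) : ℝ), ((1 + s ^ 2) / (1 - s ^ 2)) * 3, 0, 0] := by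
    rw [hLi]
    funext μ
    fin_cases μ <;> simp [hts1, hts2, hts3]
  have hyc : ((((Lorentz.boost ((2 * s / (1 + s ^ 2)) • (EuclideanSpace.single 0 1 : E3)) hw) : E4 ≃L[ℝ] E4).symm (E4.ofTimeSpace 0 ((3 : ℝ) • EuclideanSpace.single 0 1)))) 1 = ![(-((2 * s / (1 - s ^ 2)) * 3) : ℝ), ((1 + s ^ 2) / (1 - s ^ 2)) * 3, 0, 0] 1 := congrFun hy 1
  have hsp : E4.spatial ((((Lorentz.boost ((2 * s / (1 + s ^ 2)) • (EuclideanSpace.single 0 1 : E3)) hw) : E4 ≃L[ℝ] E4).symm (E4.ofTimeSpace 0 ((3 : ℝ) • EuclideanSpace.single 0 1)))) ≠ 0 := by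
    intro h
    have h' := congrArg (fun z : E3 ↦ z 0) h
    simp only [E4.spatial_apply, PiLp.zero_apply] at h'
    rw [show (0 : Fin 3).succ = 1 from rfl, hyc] at h'
    simp at h'
    rcases h' with h' | h'
    · exact h1 (by nlinarith [h'])
    · exact h2 h'
  have hnorm : E4.spatialNorm ((((Lorentz.boost ((2 * s / (1 + s ^ 2)) • (EuclideanSpace.single 0 1 : E3)) hw) : E4 ≃L[ℝ] E4).symm (E4.ofTimeSpace 0 ((3 : ℝ) • EuclideanSpace.single 0 1)))) = ((1 + s ^ 2) / (1 - s ^ 2)) * 3 := by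
    have hpos : (0 : ℝ) < ((1 + s ^ 2) / (1 - s ^ 2)) * 3 := by
      have : 0 < 1 - s ^ 2 := by linarith
      positivity
    rw [spatialNorm_eq_sqrt, congrFun hy 1, congrFun hy 2, congrFun hy 3, Real.sqrt_eq_iff_mul_self_eq_of_pos hpos]
    simp
    ring
  have hcomp : ∀ a b : E4, (fun z ↦ S z a b) =
      (fun y : E4 ↦ 2 / E4.spatialNorm y ^ 3 *
        (ell y (((Lorentz.boost ((2 * s / (1 + s ^ 2)) • (EuclideanSpace.single 0 1 : E3)) hw) : E4 ≃L[ℝ] E4).symm a) * sdot y ((WithLp.toLp 2 ![(0 : ℝ), σ₂ * (((Lorentz.boost ((2 * s / (1 + s ^ 2)) • (EuclideanSpace.single 0 1 : E3)) hw) : E4 ≃L[ℝ] E4).symm b) 3 - σ₃ * (((Lorentz.boost ((2 * s / (1 + s ^ 2)) • (EuclideanSpace.single 0 1 : E3)) hw) : E4 ≃L[ℝ] E4).symm b) 2, σ₃ * (((Lorentz.boost ((2 * s / (1 + s ^ 2)) • (EuclideanSpace.single 0 1 : E3)) hw) : E4 ≃L[ℝ] E4).symm b) 1 - σ₁ * (((Lorentz.boost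 ((2 * s / (1 + s ^ 2)) • (EuclideanSpace.single 0 1 : E3)) hw) : E4 ≃L[ℝ] E4).symm b) 3, σ₁ * (((Lorentz.boost ((2 * s / (1 + s ^ 2)) • (EuclideanSpace.single 0 1 : E3)) hw) : E4 ≃L[ℝ] E4).symm b) 2 - σ₂ * (((Lorentz.boost ((2 * s / (1 + s ^ 2)) • (EuclideanSpace.single 0 1 : E3)) hw) : E4 ≃L[ℝ] E4).symm b) 1])) + sdot y ((WithLp.toLp 2 ![(0 : ℝ), σ₂ * (((Lorentz.boost ((2 * s / (1 + s ^ 2)) • (EuclideanSpace.single 0 1 : E3)) hw) : E4 ≃L[ℝ] E4).symm a) 3 - σ₃ * (((Lorentz.boost ((2 * s / (1 + s ^ 2)) • (EuclideanSpace.single 0 1 : E3)) hw) : E4 ≃L[ℝ] E4).symm a) 2, σ₃ * (((Lorentz.boost ((2 * s / (1 + s ^ 2)) • (EuclideanSpace.single 0 1 : E3)) hw) : E4 ≃L[ℝ] E4).symm a) 1 - σ₁ * (((Lorentz.boost ((2 * s / (1 + s ^ 2)) • (EuclideanSpace.single 0 1 : E3)) hw) : E4 ≃L[ℝ] E4).symm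 a) 3, σ₁ * (((Lorentz.boost ((2 * s / (1 + s ^ 2)) • (EuclideanSpace.single 0 1 : E3)) hw) : E4 ≃L[ℝ] E4).symm a) 2 - σ₂ * (((Lorentz.boost ((2 * s / (1 + s ^ 2)) • (EuclideanSpace.single 0 1 : E3)) hw) : E4 ≃L[ℝ] E4).symm a) 1])) * ell y (((Lorentz.boost ((2 * s / (1 + s ^ 2)) • (EuclideanSpace.single 0 1 : E3)) hw) : E4 ≃L[ℝ] E4).symm b))) ∘
        ((((Lorentz.boost ((2 * s / (1 + s ^ 2)) • (EuclideanSpace.single 0 1 : E3)) hw) : E4 ≃L[ℝ] E4).symm : E4 →L[ℝ] E4)) := fun a b ↦ by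
    funext z
    simp only [Function.comp_apply, hS z a b]
    rfl
  have hD : ∀ a b c : E4, fderiv ℝ (fun z ↦ S z a b) (E4.ofTimeSpace 0 ((3 : ℝ) • EuclideanSpace.single 0 1)) c =
      fderiv ℝ (fun y : E4 ↦ 2 / E4.spatialNorm y ^ 3 *
        (ell y (((Lorentz.boost ((2 * s / (1 + s ^ 2)) • (EuclideanSpace.single 0 1 : E3)) hw) : E4 ≃L[ℝ] E4).symm a) * sdot y ((WithLp.toLp 2 ![(0 : ℝ), σ₂ * (((Lorentz.boost ((2 * s / (1 + s ^ 2)) • (EuclideanSpace.single 0 1 : E3)) hw) : E4 ≃L[ℝ] E4).symm b) 3 - σ₃ * (((Lorentz.boost ((2 * s / (1 + s ^ 2)) • (EuclideanSpace.single 0 1 : E3)) hw) : E4 ≃L[ℝ] E4).symm b) 2, σ₃ * (((Lorentz.boost ((2 * s / (1 + s ^ 2)) • (EuclideanSpace.single 0 1 : E3)) hw) : E4 ≃L[ℝ] E4).symm b) 1 - σ₁ * (((Lorentz.boost ((2 * s / (1 + s ^ 2)) • (EuclideanSpace.single 0 1 : E3)) hw) : E4 ≃L[ℝ] E4).symm b)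 3, σ₁ * (((Lorentz.boost ((2 * s / (1 + s ^ 2)) • (EuclideanSpace.single 0 1 : E3)) hw) : E4 ≃L[ℝ] E4).symm b) 2 - σ₂ * (((Lorentz.boost ((2 * s / (1 + s ^ 2)) • (EuclideanSpace.single 0 1 : E3)) hw) : E4 ≃L[ℝ] E4).symm b) 1])) + sdot y ((WithLp.toLp 2 ![(0 : ℝ), σ₂ * (((Lorentz.boost ((2 * s / (1 + s ^ 2)) • (EuclideanSpace.single 0 1 : E3)) hw) : E4 ≃L[ℝ] E4).symm a) 3 - σ₃ * (((Lorentz.boost ((2 * s / (1 + s ^ 2)) • (EuclideanSpace.single 0 1 : E3)) hw) : E4 ≃L[ℝ] E4).symm a) 2, σ₃ * (((Lorentz.boost ((2 * s / (1 + s ^ 2)) • (EuclideanSpace.single 0 1 : E3)) hw) : E4 ≃L[ℝ] E4).symm a) 1 - σ₁ * (((Lorentz.boost ((2 * s / (1 + s ^ 2)) • (EuclideanSpace.single 0 1 : E3)) hw) : E4 ≃L[ℝ] E4).symm a) 3, σ₁ * (((Lorentz.boost ((2 * s / (1 + s ^ 2)) • (EuclideanSpace.single 0 1 : E3)) hw)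 : E4 ≃L[ℝ] E4).symm a) 2 - σ₂ * (((Lorentz.boost ((2 * s / (1 + s ^ 2)) • (EuclideanSpace.single 0 1 : E3)) hw) : E4 ≃L[ℝ] E4).symm a) 1])) * ell y (((Lorentz.boost ((2 * s / (1 + s ^ 2)) • (EuclideanSpace.single 0 1 : E3)) hw) : E4 ≃L[ℝ] E4).symm b))) (((Lorentz.boost ((2 * s / (1 + s ^ 2)) • (EuclideanSpace.single 0 1 : E3)) hw) : E4 ≃L[ℝ] E4).symm (E4.ofTimeSpace 0 ((3 : ℝ) • EuclideanSpace.single 0 1))) (((Lorentz.boost ((2 * s / (1 + s ^ 2)) • (EuclideanSpace.single 0 1 : E3)) hw) : E4 ≃L[ℝ] E4).symm c) := by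
    intro a b c
    have hat := hasFDerivAt_ltAtom hsp (((Lorentz.boost ((2 * s / (1 + s ^ 2)) • (EuclideanSpace.single 0 1 : E3)) hw) : E4 ≃L[ℝ] E4).symm a) (((Lorentz.boost ((2 * s / (1 + s ^ 2)) • (EuclideanSpace.single 0 1 : E3)) hw) : E4 ≃L[ℝ] E4).symm b) (WithLp.toLp 2 ![(0 : ℝ), σ₂ * (((Lorentz.boost ((2 * s / (1 + s ^ 2)) • (EuclideanSpace.single 0 1 : E3)) hw) : E4 ≃L[ℝ] E4).symm a) 3 - σ₃ * (((Lorentz.boost ((2 * s / (1 + s ^ 2)) • (EuclideanSpace.single 0 1 : E3)) hw) : E4 ≃L[ℝ] E4).symm a) 2, σ₃ * (((Lorentz.boost ((2 * s / (1 + s ^ 2)) • (EuclideanSpace.single 0 1 : E3)) hw) : E4 ≃L[ℝ] E4).symm a) 1 - σ₁ * (((Lorentz.boost ((2 * s / (1 + s ^ 2)) • (EuclideanSpace.single 0 1 : E3)) hw) : E4 ≃L[ℝ] E4).symm a) 3, σ₁ * (((Lorentz.boost ((2 * s / (1 + s ^ 2)) • (EuclideanSpace.single 0 1 : E3)) hw)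 : E4 ≃L[ℝ] E4).symm a) 2 - σ₂ * (((Lorentz.boost ((2 * s / (1 + s ^ 2)) • (EuclideanSpace.single 0 1 : E3)) hw) : E4 ≃L[ℝ] E4).symm a) 1]) (WithLp.toLp 2 ![(0 : ℝ), σ₂ * (((Lorentz.boost ((2 * s / (1 + s ^ 2)) • (EuclideanSpace.single 0 1 : E3)) hw) : E4 ≃L[ℝ] E4).symm b) 3 - σ₃ * (((Lorentz.boost ((2 * s / (1 + s ^ 2)) • (EuclideanSpace.single 0 1 : E3)) hw) : E4 ≃L[ℝ] E4).symm b) 2, σ₃ * (((Lorentz.boost ((2 * s / (1 + s ^ 2)) • (EuclideanSpace.single 0 1 : E3)) hw) : E4 ≃L[ℝ] E4).symm b) 1 - σ₁ * (((Lorentz.boost ((2 * s / (1 + s ^ 2)) • (EuclideanSpace.single 0 1 : E3)) hw) : E4 ≃L[ℝ] E4).symm b) 3, σ₁ * (((Lorentz.boost ((2 * s / (1 + s ^ 2)) • (EuclideanSpace.single 0 1 : E3)) hw) : E4 ≃L[ℝ] E4).symm b) 2 - σ₂ * (((Lorentz.boost ((2 * s / (1 + s ^ 2)) • (EuclideanSpace.single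 0 1 : E3)) hw) : E4 ≃L[ℝ] E4).symm b) 1])
    have hSD := (hat.comp (E4.ofTimeSpace 0 ((3 : ℝ) • EuclideanSpace.single 0 1)) (((((Lorentz.boost ((2 * s / (1 + s ^ 2)) • (EuclideanSpace.single 0 1 : E3)) hw) : E4 ≃L[ℝ] E4).symm : E4 →L[ℝ] E4)).hasFDerivAt)).congr_of_eventuallyEq
      (Filter.EventuallyEq.of_eq (hcomp a b))
    rw [hSD.fderiv, ← hat.fderiv]
    rfl
  have hs3 : ((2 : Fin 3).succ : Fin 4) = 3 := rfl
  rw [Fin.sum_univ_three]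
  simp only [Fin.succ_zero_eq_one, Fin.succ_one_eq_two, hs3, hD, fderiv_ltAtom_apply hsp]
  simp only [ell, dEll, sdot_eq, hnorm]
  simp only [hy, hL1, hL2, hL3, Matrix.cons_val_zero, Matrix.cons_val_one,
    Matrix.head_cons, Matrix.cons_val_two, Matrix.tail_cons, Matrix.cons_val_three,
    mul_zero, zero_mul, add_zero, zero_add, mul_one, sub_zero, zero_sub, neg_zero, zero_div, mul_neg, neg_mul]
  field_simp
  ring

/-- Registered carrier `slaving_farFieldSpinRowsA_slaving12` of the crux item (= `farField_spinRow_P2`). [folklore] -/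
theorem slaving_farFieldSpinRowsA_slaving12 : open Literature.Geometry.Lorentzian Literature.Geometry.Lorentzian.Schwarzschild in ∀ {s : ℝ} (hs : |s| < 1) (hw : ‖((2 * s / (1 + s ^ 2)) • (EuclideanSpace.single 0 1 : E3))‖ < 1) (σ₁ σ₂ σ₃ : ℝ) (S : E4 → E4 → E4 → ℝ) (hS : ∀ z u w : E4, S z u w = 2 / E4.spatialNorm (((Lorentz.boost ((2 * s / (1 + s ^ 2)) • (EuclideanSpace.single 0 1 : E3)) hw) : E4 ≃L[ℝ] E4).symm z) ^ 3 * (ell (((Lorentz.boost ((2 * s / (1 + s ^ 2)) • (EuclideanSpace.single 0 1 : E3)) hw) : E4 ≃L[ℝ] E4).symm z) (((Lorentz.boost ((2 * s / (1 + s ^ 2)) • (EuclideanSpace.single 0 1 : E3)) hw) : E4 ≃L[ℝ] E4).symm u) * sdot (((Lorentz.boost ((2 * s / (1 + s ^ 2)) • (EuclideanSpace.single 0 1 : E3)) hw) : E4 ≃L[ℝ] E4).symm z) ((WithLp.toLp 2 ![(0 : ℝ), σ₂ * (((Lorentz.boost ((2 * s / (1 + s ^ 2)) • (EuclideanSpace.single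 0 1 : E3)) hw) : E4 ≃L[ℝ] E4).symm w) 3 - σ₃ * (((Lorentz.boost ((2 * s / (1 + s ^ 2)) • (EuclideanSpace.single 0 1 : E3)) hw) : E4 ≃L[ℝ] E4).symm w) 2, σ₃ * (((Lorentz.boost ((2 * s / (1 + s ^ 2)) • (EuclideanSpace.single 0 1 : E3)) hw) : E4 ≃L[ℝ] E4).symm w) 1 - σ₁ * (((Lorentz.boost ((2 * s / (1 + s ^ 2)) • (EuclideanSpace.single 0 1 : E3)) hw) : E4 ≃L[ℝ] E4).symm w) 3, σ₁ * (((Lorentz.boost ((2 * s / (1 + s ^ 2)) • (EuclideanSpace.single 0 1 : E3)) hw) : E4 ≃L[ℝ] E4).symm w) 2 - σ₂ * (((Lorentz.boost ((2 * s / (1 + s ^ 2)) • (EuclideanSpace.single 0 1 : E3)) hw) : E4 ≃L[ℝ] E4).symm w) 1])) + sdot (((Lorentz.boost ((2 * s / (1 + s ^ 2)) • (EuclideanSpace.single 0 1 : E3)) hw) : E4 ≃L[ℝ] E4).symm z) ((WithLp.toLp 2 ![(0 : ℝ), σ₂ * (((Lorentz.boost ((2 * s / (1 + s ^ 2)) •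 (EuclideanSpace.single 0 1 : E3)) hw) : E4 ≃L[ℝ] E4).symm u) 3 - σ₃ * (((Lorentz.boost ((2 * s / (1 + s ^ 2)) • (EuclideanSpace.single 0 1 : E3)) hw) : E4 ≃L[ℝ] E4).symm u) 2, σ₃ * (((Lorentz.boost ((2 * s / (1 + s ^ 2)) • (EuclideanSpace.single 0 1 : E3)) hw) : E4 ≃L[ℝ] E4).symm u) 1 - σ₁ * (((Lorentz.boost ((2 * s / (1 + s ^ 2)) • (EuclideanSpace.single 0 1 : E3)) hw) : E4 ≃L[ℝ] E4).symm u) 3, σ₁ * (((Lorentz.boost ((2 * s / (1 + s ^ 2)) • (EuclideanSpace.single 0 1 : E3)) hw) : E4 ≃L[ℝ] E4).symm u) 2 - σ₂ * (((Lorentz.boost ((2 * s / (1 + s ^ 2)) • (EuclideanSpace.single 0 1 : E3)) hw) : E4 ≃L[ℝ] E4).symm u) 1])) * ell (((Lorentz.boost ((2 * s / (1 + s ^ 2)) • (EuclideanSpace.single 0 1 : E3)) hw) : E4 ≃L[ℝ] E4).symm z) (((Lorentz.boost ((2 * s / (1 + s ^ 2)) • (EuclideanSpace.single 0 1 : E3))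 hw) : E4 ≃L[ℝ] E4).symm w))), ∑ i : Fin 3, (fderiv ℝ (fun z ↦ S z (E4.basisVector i.succ) (E4.basisVector 2)) (E4.ofTimeSpace 0 ((3 : ℝ) • EuclideanSpace.single 0 1)) (E4.basisVector i.succ) - fderiv ℝ (fun z ↦ S z (E4.basisVector i.succ) (E4.basisVector i.succ)) (E4.ofTimeSpace 0 ((3 : ℝ) • EuclideanSpace.single 0 1)) (E4.basisVector 2)) = -(2 / 27) * ((1 - s ^ 2) / (1 + s ^ 2)) ^ 3 * σ₃ :=
  farField_spinRow_P2

end Summit.FinalStateConjecture.FinalStateConjecture.Theorems.SublinearIsFree.Slaving
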